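import Mathlib
import Summits.ValiantsHypothesis.ValiantsHypothesis.Theses.BarrierLever
import Summits.ValiantsHypothesis.ValiantsHypothesis.Theorems.BarrierLeverDefinableEquationsVNPVersusVPSPACEDcSlice
import Summits.ValiantsHypothesis.ValiantsHypothesis.Theorems.BarrierLeverDcSliceCoversVP

/-!
# Crux `BarrierLever.DefinableDcEquations` (stmt-8746) — GROWTH-FREE NORMAL FORM:
# one level against EVERY quasi-polynomial determinantal slice (val-np-p5 g26)

Item stmt-8746 `DefinableDcEquations` is filed with an existential threshold function and a growth
clause:

  `∃ m, (∀ C, eventually 2^(C (log₂ n + 1)²) ≤ m n) ∧ ∃ a n₀, ∀ n ≥ n₀, Eq_a(n, dc ≤ m n)`,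

where `Eq_a(n, dc ≤ M)` says that some nonzero level-`a` boolean sum in the `N = C(2n,n)`
coefficient variables vanishes at `coeff f` for every `f` with `deg f ≤ n` and `dc f ≤ M`.
This file removes the function quantifier: by a diagonal choice of the exponent
(`C(n) := max {C ≤ n : n₀(C) ≤ n}`, `Nat.findGreatest`, exactly as the size-axis normal form
`Superpolynomial.definableEquations_iff_superpolynomial` of the sister crux 8745 diagonalises over `b`)

  `DefinableDcEquations ⟺ ∃ a, ∀ C, ∃ n₀, ∀ n ≥ n₀, Eq_a(n, dc ≤ 2^(C (log₂ n + 1)²))`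
  (`definableDcEquations_iff_forallExponent`),

i.e. 8746 is, in the SAME quantifier shape `∃ a ∀ C` as 8745's `∃ a ∀ b`, the statement "ONE level
of boolean-sum equations against the degree-`≤ n` slice of EVERY quasi-polynomial determinantal
class `dc ≤ n^(C log₂ n)`", with no threshold function and no growth clause.  Consequences recorded:

* `not_definableDcEquations_iff_forallExponent` — the refuter-facing form: 8746 FAILS iff for every
  level `a` SOME quasi-polynomial determinantal slice `{deg ≤ n, dc ≤ 2^(C(log₂ n+1)²)}` is a hitting
  set against all nonzero level-`a` boolean sums infinitely often (one exponent `C = C(a)`; compare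
  `Status`-file `not_definableDcEquations_iff`, which quantifies over all admissible threshold
  functions);
* `definableDcEquations_of_quasiSizeEquations` — the SIZE version one scale up implies 8746: if one
  level kills `{deg ≤ n, L ≤ 2^(C (log₂ n + 1)²)}` for every `C` (boolean-sum equations for the
  degree-`n` slice of `VQP`), then `DefinableDcEquations` (by `L(f) ≤ 8(dc f + 1)^7 + (dc f)²(2n+1)`,
  tree `VNPVersusVPSPACE.complexity_le_of_dc_le`, and `8(M+1)^7 + M²(2n+1) ≤ 2^((7C+12)(log₂ n+1)²)`
  at `M = 2^(C(log₂ n+1)²)`);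
* `vqp_sandwich` — `[∃ a ∀ C Eq_a(L ≤ 2^(C(log₂ n+1)²))] ⇒ DefinableDcEquations ⇒ DefinableEquations`
  (the second arrow is the tree's `dcSliceCoversVP_proof`), placing 8746 between "definable
  equations for the `VQP` slices" and "definable equations for the `VP` slices" (= 8745 ⟺ 8749).

Reductions only: all three items stay OPEN (Chatterjee–Tengse 2023 §1.3 direction 2) and nothing
here bears on `SuccinctHittingSetsForVP` or on `VP ≠ VNP`, which is NOT proved.  No definitions,
no named facts.
Refs: Forbes–Shpilka–Volk 2018 Def. 1.1 / Question 6; Chatterjee–Tengse arXiv:2309.07612 §1.3;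
Bürgisser 2000 Ch. 2 and Bürgisser–Clausen–Shokrollahi 1997 Thm. (21.36) (dc versus circuit size).
-/

set_option linter.dupNamespace false

noncomputable section

namespace Summit.ValiantsHypothesis.ValiantsHypothesis.Theorems.BarrierLeverDefinableDcEquations

open MvPolynomial
open Literature.Computability.AlgebraicComplexity Literature.Barriers.ValiantsHypothesis
open Summit.ValiantsHypothesis.ValiantsHypothesis.Theses.BarrierLever
open Summit.ValiantsHypothesis.ValiantsHypothesis.Theorems.BarrierLeverDefinableEquations
open scoped BigOperators

namespace QuasiExponent

/-! ## 1. From the filed form (`∃ m` + growth clause) to `∃ a ∀ C` -/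

/-- **8746 ⇒ one level against EVERY quasi-polynomial determinantal slice.**  If
`DefinableDcEquations` holds with threshold `m`, level `a` and onset `n₀`, then for every exponent
`C`, from `max n₀ n₁(C)` on (where `n₁(C)` is the onset of `2^(C(log₂ n+1)²) ≤ m n`), the crux's own
witness kills every `f` with `deg f ≤ n` and `dc f ≤ 2^(C (log₂ n + 1)²)`. [folklore] -/
theorem forallExponent_of_definableDcEquations (h : DefinableDcEquations) :
    ∃ a : ℕ, ∀ C : ℕ, ∃ n₀ : ℕ, ∀ n ≥ n₀, ∃ q : ℕ, q ≤ (Nat.choose (2 * n) n) ^ a ∧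
      ∃ H : MvPolynomial (↥(degLEMonomials n) ⊕ Fin q) ℂ,
        complexity H ≤ (Nat.choose (2 * n) n) ^ a ∧ H.totalDegree ≤ (Nat.choose (2 * n) n) ^ a ∧
        boolSum H ≠ 0 ∧
        ∀ f : MvPolynomial (Fin n) ℂ, f.totalDegree ≤ n →
          determinantalComplexity f ≤ 2 ^ (C * (Nat.log 2 n + 1) ^ 2) →
          eval (coeffVector (degLEMonomials n) f) (boolSum H) = 0 := by
  obtain ⟨m, hgrowth, a, n₀, hdef⟩ := h
  refine ⟨a, fun C => ?_⟩
  obtain ⟨n₁, hn₁⟩ := hgrowth C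
  refine ⟨max n₀ n₁, fun n hn => ?_⟩
  obtain ⟨q, hq, H, hHc, hHd, hne, hvan⟩ := hdef n (le_trans (le_max_left _ _) hn)
  exact ⟨q, hq, H, hHc, hHd, hne,
    fun f hfd hdc => hvan f hfd (hdc.trans (hn₁ n (le_trans (le_max_right _ _) hn)))⟩

/-! ## 2. The diagonal: from `∃ a ∀ C` back to one admissible threshold function -/

/-- **One level against every quasi-polynomial determinantal slice ⇒ 8746.**  Given level `a` and
onsets `n₀(C)`, the diagonal exponent `C(n) := Nat.findGreatest (fun C => n₀ C ≤ n) n` and the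
threshold `m n := 2^(C(n) (log₂ n + 1)²)` satisfy the growth clause (`C ≤ C(n)` once
`n ≥ max (n₀ C) C`) and carry the equations from `n₀ 0` on (`n₀ (C n) ≤ n` there). [folklore] -/
theorem definableDcEquations_of_forallExponent
    (h : ∃ a : ℕ, ∀ C : ℕ, ∃ n₀ : ℕ, ∀ n ≥ n₀, ∃ q : ℕ, q ≤ (Nat.choose (2 * n) n) ^ a ∧
      ∃ H : MvPolynomial (↥(degLEMonomials n) ⊕ Fin q) ℂ,
        complexity H ≤ (Nat.choose (2 * n) n) ^ a ∧ H.totalDegree ≤ (Nat.choose (2 * n) n) ^ a ∧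
        boolSum H ≠ 0 ∧
        ∀ f : MvPolynomial (Fin n) ℂ, f.totalDegree ≤ n →
          determinantalComplexity f ≤ 2 ^ (C * (Nat.log 2 n + 1) ^ 2) →
          eval (coeffVector (degLEMonomials n) f) (boolSum H) = 0) :
    DefinableDcEquations := by
  obtain ⟨a, h⟩ := h
  choose n₀ hn₀ using h
  unfold DefinableDcEquations
  refine ⟨fun n => 2 ^ (Nat.findGreatest (fun C => n₀ C ≤ n) n * (Nat.log 2 n + 1) ^ 2),
    fun C => ?_, a, n₀ 0, fun n hn => ?_⟩
  · -- growth clause: every fixed exponent is eventually below the diagonal exponent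
    refine ⟨max (n₀ C) C, fun n hn => ?_⟩
    have hC : C ≤ n := le_trans (le_max_right _ _) hn
    have hnC : n₀ C ≤ n := le_trans (le_max_left _ _) hn
    exact Nat.pow_le_pow_right (by norm_num)
      (Nat.mul_le_mul_right _ (Nat.le_findGreatest hC hnC))
  · -- equations: the witness at the diagonal exponent
    have hspec : n₀ (Nat.findGreatest (fun C => n₀ C ≤ n) n) ≤ n :=
      Nat.findGreatest_spec (P := fun C => n₀ C ≤ n) (Nat.zero_le n) hn
    obtain ⟨q, hq, H, hHc, hHd, hne, hvan⟩ := hn₀ _ n hspec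
    exact ⟨q, hq, H, hHc, hHd, hne, fun f hfd hdc => hvan f hfd hdc⟩

/-- **GROWTH-FREE NORMAL FORM of crux 8746.**  `DefinableDcEquations` (filed as `∃ m` with the
growth clause `∀ C, eventually 2^(C(log₂ n+1)²) ≤ m n`) is EQUIVALENT to: some level `a` such that
for EVERY exponent `C`, for all large `n`, a nonzero level-`a` boolean sum (`q ≤ N^a`,
`L(H), deg H ≤ N^a`, `N = C(2n,n)`) vanishes at `coeff f` for every `f` with `deg f ≤ n` and
`dc f ≤ 2^(C (log₂ n + 1)²)` — the exact `∃ a ∀ C` analogue, on the determinantal axis at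
quasi-polynomial scale, of the sister crux `DefinableEquations` (`∃ a ∀ b`, size `n ^ b`).
[folklore] -/
theorem definableDcEquations_iff_forallExponent :
    DefinableDcEquations ↔
      ∃ a : ℕ, ∀ C : ℕ, ∃ n₀ : ℕ, ∀ n ≥ n₀, ∃ q : ℕ, q ≤ (Nat.choose (2 * n) n) ^ a ∧
        ∃ H : MvPolynomial (↥(degLEMonomials n) ⊕ Fin q) ℂ,
          complexity H ≤ (Nat.choose (2 * n) n) ^ a ∧ H.totalDegree ≤ (Nat.choose (2 * n) n) ^ a ∧
          boolSum H ≠ 0 ∧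
          ∀ f : MvPolynomial (Fin n) ℂ, f.totalDegree ≤ n →
            determinantalComplexity f ≤ 2 ^ (C * (Nat.log 2 n + 1) ^ 2) →
            eval (coeffVector (degLEMonomials n) f) (boolSum H) = 0 :=
  ⟨forallExponent_of_definableDcEquations, definableDcEquations_of_forallExponent⟩

/-! ## 3. The negation, refuter-facing: one quasi-polynomial slice per level suffices -/

/-- **¬8746 in the normal form.**  `DefinableDcEquations` FAILS iff for every level `a` there is
ONE exponent `C` such that, for infinitely many `n`, every nonzero level-`a` boolean sum is nonzero
at the coefficient vector of some `f` with `deg f ≤ n` and `dc f ≤ 2^(C (log₂ n + 1)²)`: per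
level, a single quasi-polynomial determinantal slice is a succinct hitting set against `VNP(N)`-type
distinguishers infinitely often.  Contrapositive of `definableDcEquations_iff_forallExponent`;
compare `Status`'s `not_definableDcEquations_iff` (all admissible threshold functions at once).
[folklore] -/
theorem not_definableDcEquations_iff_forallExponent :
    ¬ DefinableDcEquations ↔
      ∀ a : ℕ, ∃ C : ℕ, ∀ n₀ : ℕ, ∃ n : ℕ, n₀ ≤ n ∧ ∀ q : ℕ, q ≤ (Nat.choose (2 * n) n) ^ a →
        ∀ H : MvPolynomial (↥(degLEMonomials n) ⊕ Fin q) ℂ,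
          complexity H ≤ (Nat.choose (2 * n) n) ^ a → H.totalDegree ≤ (Nat.choose (2 * n) n) ^ a →
          boolSum H ≠ 0 →
          ∃ f : MvPolynomial (Fin n) ℂ, f.totalDegree ≤ n ∧
            determinantalComplexity f ≤ 2 ^ (C * (Nat.log 2 n + 1) ^ 2) ∧
            eval (coeffVector (degLEMonomials n) f) (boolSum H) ≠ 0 := by
  rw [definableDcEquations_iff_forallExponent]
  constructor
  · intro h a
    by_contra hcon
    push Not at hcon
    refine h ⟨a, fun C => ?_⟩
    obtain ⟨n₀, hn₀⟩ := hcon C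
    refine ⟨n₀, fun n hn => ?_⟩
    obtain ⟨q, hq, H, hH, hdeg, h0, hvan⟩ := hn₀ n hn
    exact ⟨q, hq, H, hH, hdeg, h0, fun f hfd hdc => hvan f hfd hdc⟩
  · rintro h ⟨a, ha⟩
    obtain ⟨C, hC⟩ := h a
    obtain ⟨n₀, hn₀⟩ := ha C
    obtain ⟨n, hn, hhit⟩ := hC n₀
    obtain ⟨q, hq, H, hH, hdeg, h0, hvan⟩ := hn₀ n hn
    obtain ⟨f, hfd, hdc, hne⟩ := hhit q hq H hH hdeg h0
    exact hne (hvan f hfd hdc)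

/-! ## 4. One scale up on the size axis: equations for the `VQP` slices imply 8746 -/

/-- Arithmetic of the determinantal cost at quasi-polynomial scale: with `M = 2^(C (log₂ n+1)²)`,
`8 (M+1)^7 + M² (2n+1) ≤ 2^((7C+12) (log₂ n + 1)²)`. [folklore] -/
theorem dcCost_quasi_le (n C : ℕ) :
    8 * (2 ^ (C * (Nat.log 2 n + 1) ^ 2) + 1) ^ 7 +
        (2 ^ (C * (Nat.log 2 n + 1) ^ 2)) ^ 2 * (2 * n + 1) ≤
      2 ^ ((7 * C + 12) * (Nat.log 2 n + 1) ^ 2) := by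
  set L := Nat.log 2 n with hL
  set K := (L + 1) ^ 2 with hK
  have hK1 : L + 1 ≤ K := by
    rw [hK, pow_two]; exact Nat.le_mul_of_pos_left _ (Nat.succ_pos L)
  have hKpos : 1 ≤ K := le_trans (Nat.succ_le_succ (Nat.zero_le L)) hK1
  have hn : n < 2 ^ (L + 1) := Nat.lt_pow_succ_log_self Nat.one_lt_two n
  have h2n : 2 * n + 1 ≤ 2 ^ (L + 2) := by
    rw [pow_succ]; omega
  -- first summand
  have hA : 8 * (2 ^ (C * K) + 1) ^ 7 ≤ 2 ^ (7 * C * K + 10) := by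
    have h1 : 2 ^ (C * K) + 1 ≤ 2 ^ (C * K + 1) := by
      rw [pow_succ]; have := Nat.one_le_two_pow (n := C * K); omega
    calc 8 * (2 ^ (C * K) + 1) ^ 7 ≤ 8 * (2 ^ (C * K + 1)) ^ 7 := by gcongr
      _ = 2 ^ (7 * C * K + 10) := by
          rw [← pow_mul, show (8 : ℕ) = 2 ^ 3 by norm_num, ← pow_add]; ring_nf
  -- second summand
  have hB : (2 ^ (C * K)) ^ 2 * (2 * n + 1) ≤ 2 ^ (2 * C * K + (L + 2)) := by
    calc (2 ^ (C * K)) ^ 2 * (2 * n + 1) ≤ (2 ^ (C * K)) ^ 2 * 2 ^ (L + 2) := by gcongr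
      _ = 2 ^ (2 * C * K + (L + 2)) := by rw [← pow_mul, ← pow_add]; ring_nf
  -- both exponents are at most `(7C+11) K + 1`, and their sum is at most `2^((7C+12) K)`
  have hE1 : 7 * C * K + 10 ≤ (7 * C + 11) * K := by nlinarith
  have hE2 : 2 * C * K + (L + 2) ≤ (7 * C + 11) * K := by nlinarith
  calc 8 * (2 ^ (C * K) + 1) ^ 7 + (2 ^ (C * K)) ^ 2 * (2 * n + 1)
      ≤ 2 ^ ((7 * C + 11) * K) + 2 ^ ((7 * C + 11) * K) :=
        Nat.add_le_add (hA.trans (Nat.pow_le_pow_right (by norm_num) hE1))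
          (hB.trans (Nat.pow_le_pow_right (by norm_num) hE2))
    _ = 2 ^ ((7 * C + 11) * K + 1) := by rw [pow_succ]; ring
    _ ≤ 2 ^ ((7 * C + 12) * K) := Nat.pow_le_pow_right (by norm_num) (by nlinarith)

/-- **Boolean-sum equations for the degree-`n` slices of `VQP` imply crux 8746.**  If ONE level `a`
kills, for every exponent `C` and all large `n`, every `f` with `deg f ≤ n` and circuit size
`L(f) ≤ 2^(C (log₂ n + 1)²)`, then `DefinableDcEquations` holds: the determinantal slice
`dc f ≤ 2^(C(log₂ n+1)²)` lies inside the size slice `L(f) ≤ 2^((7C+12)(log₂ n+1)²)`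
(`VNPVersusVPSPACE.complexity_le_of_dc_le`, `dcCost_quasi_le`), and §2 diagonalises. [folklore] -/
theorem definableDcEquations_of_quasiSizeEquations
    (h : ∃ a : ℕ, ∀ C : ℕ, ∃ n₀ : ℕ, ∀ n ≥ n₀, ∃ q : ℕ, q ≤ (Nat.choose (2 * n) n) ^ a ∧
      ∃ H : MvPolynomial (↥(degLEMonomials n) ⊕ Fin q) ℂ,
        complexity H ≤ (Nat.choose (2 * n) n) ^ a ∧ H.totalDegree ≤ (Nat.choose (2 * n) n) ^ a ∧
        boolSum H ≠ 0 ∧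
        ∀ f : MvPolynomial (Fin n) ℂ, f.totalDegree ≤ n →
          complexity f ≤ 2 ^ (C * (Nat.log 2 n + 1) ^ 2) →
          eval (coeffVector (degLEMonomials n) f) (boolSum H) = 0) :
    DefinableDcEquations := by
  obtain ⟨a, h⟩ := h
  refine definableDcEquations_of_forallExponent ⟨a, fun C => ?_⟩
  obtain ⟨n₀, hn₀⟩ := h (7 * C + 12)
  refine ⟨n₀, fun n hn => ?_⟩
  obtain ⟨q, hq, H, hHc, hHd, hne, hvan⟩ := hn₀ n hn
  refine ⟨q, hq, H, hHc, hHd, hne, fun f hfd hdc => hvan f hfd ?_⟩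
  calc complexity f
      ≤ 8 * (2 ^ (C * (Nat.log 2 n + 1) ^ 2) + 1) ^ 7 +
          (2 ^ (C * (Nat.log 2 n + 1) ^ 2)) ^ 2 * (2 * n + 1) :=
        VNPVersusVPSPACE.complexity_le_of_dc_le hdc
    _ ≤ 2 ^ ((7 * C + 12) * (Nat.log 2 n + 1) ^ 2) := dcCost_quasi_le n C

/-- **The `VQP` sandwich, recorded.**  (i) Boolean-sum equations at one level for the degree-`n`
slices of `VQP` (`L ≤ 2^(C(log₂ n+1)²)`, every `C`) imply `DefinableDcEquations` (this file);
(ii) `DefinableDcEquations → DefinableEquations` (tree: `dcSliceCoversVP_proof`, VSBR depth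
reduction `dc ≤ 2^(17 (max b 1)² (log₂ n+1)²)` on `SmallCircuits ℂ n b`).  So crux 8746 sits
between "definable equations for `VQP`" and "definable equations for `VP`" (= crux 8745 ⟺ item
8749); the two differ by the `VP`/`VQP` loss of depth reduction. [folklore] -/
theorem vqp_sandwich :
    ((∃ a : ℕ, ∀ C : ℕ, ∃ n₀ : ℕ, ∀ n ≥ n₀, ∃ q : ℕ, q ≤ (Nat.choose (2 * n) n) ^ a ∧
        ∃ H : MvPolynomial (↥(degLEMonomials n) ⊕ Fin q) ℂ,
          complexity H ≤ (Nat.choose (2 * n) n) ^ a ∧ H.totalDegree ≤ (Nat.choose (2 * n) n) ^ a ∧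
          boolSum H ≠ 0 ∧
          ∀ f : MvPolynomial (Fin n) ℂ, f.totalDegree ≤ n →
            complexity f ≤ 2 ^ (C * (Nat.log 2 n + 1) ^ 2) →
            eval (coeffVector (degLEMonomials n) f) (boolSum H) = 0) → DefinableDcEquations) ∧
    (DefinableDcEquations → DefinableEquations) :=
  ⟨definableDcEquations_of_quasiSizeEquations,
    Summit.ValiantsHypothesis.ValiantsHypothesis.Theorems.dcSliceCoversVP_proof⟩

end QuasiExponent

end Summit.ValiantsHypothesis.ValiantsHypothesis.Theorems.BarrierLeverDefinableDcEquations

end
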